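import Summits.QuantumFields.BalabanUV.Beta.GAN24.T2ShapeHalfMemberOfDivergences
import Summits.QuantumFields.BalabanUV.Beta.GAN24.HalfMemberSlavedDivergenceLetters

/-!
# `BalabanUV.Beta.GAN24.T2ShapeHalfMemberOfLetterRows` — binder row G-an2-4 ∕ (CONV-C), W-slot, the (α-0) parity re-cut: **THE (α-0) SHAPE END WITH THE SLOT ROWS
# DISCHARGED LEVEL BY LEVEL** — FILE 3b of the journal INTENT [LEAF03-G66-ONLINE] «DIVERGENCE LETTERS ⇒ CELL»: FILE 3a's END (`T2ShapeHalfMemberOfDivergences`) with its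
# two SLOT letter rows `h₂ h₁` (`∀ l`) SUPPLIED — member `0` by FILE 2 §0 from the Wilson ∕ border table's own shape (p2's `locStencil₂_unitS₂_T2RecAt_zero`), members `l+1`
# by leaf-01 g72's (b1) PART 4 `HalfMemberSlavedDivergenceLetters.slotLetters_halfMember_succ_of_rows` from p2's F4 (`T2RecSourceRows.source_rows_three_of_srecAt_rows`, BY
# NAME from the S-slot rows) + the RAW TABLE LAWS WITH PARITIES (letters `S_l X R_l R″_l cH_l`, DISPLAYED per level) + the two S-SLOT ROWS `hE₁ hE₂` on the slaved
# summand (DISPLAYED per level with ONE constant; at `ε = 1` p2 g45's `BlockCommutatorStepLetter` over MY `SlavedSummandLetterRows` discharges them at `d = 3`).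

NOT IN PRINT; OUR BOOKKEEPING (G-an2-4 crux team (2), leaf prover `b2b-balaban-gan24-formalise-leaf-03`, gen 66).  [folklore] composition BY NAME; 0 `def`, 0 cited facts,
0 `def … : Prop`, 0 sorry.  HONEST FRAMING (cell contract, verbatim): «discharging `BetaPertH` makes Bałaban's UV stability UNCONDITIONAL — a real constructive-QFT result;
it is NOT the continuum limit and NOT the Clay problem.»  HONEST DEPENDENCY (verbatim): «continuum YM on T⁴ ⇐ BetaPertH ∧ nine spine estimates (0/9 proved); BetaPertH ⇐
(D1) ∧ (D4) ∧ CAP+tail; G-an2-4 gates asym, D1 and NE2/3/4.»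

## What (`d = 3`, `2 ≤ Lc`, in-block root `r`, `|cE₂| ≤ Lc^8`, any `cE cVH cΛ cB Tc`, off-diagonal `Lc`-covariant `LocStencil₂` border `vh₂S`, every `ε` with `|ε| ≤ 1`)
* §0 `rows_of_zero_succ` — a member-`0` row and a uniform successor row merge into ONE row (`max` of constants, `min` of rates).
* §1 **`locStencil₂_halfMember_three_of_letterRows`** — «T2Shape^{ε}»: `∃ C₂ δ₂, 0 < δ₂ ∧ ∀ n, LocStencil₂ (y_n) C₂ δ₂`, `y_n = ½ • (T♮̃_n + ε • P T♮̃_n)`, from EXACTLY: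
  the S-slot rows `(hS, hSall)`; the border rows; the pin; per level `l` the RAW table laws `hTL ∕ hTL″` of D1's shape with letters `S_l X R_l R″_l cH_l` and parities
  `hCm` (commutator EVEN) ∕ `hR ∕ hR″` (remainders ODD) — at D1's literal these are leaf-01's PART 3 pin (`S_l = SpureRecAt … l`, `X_p = diagK (½ • Σ_v legInd ρ (Lc•p+v))`,
  d1-leaf-05's `trK_SpureRecAt`, p2's residual parity); the two S-slot rows `hE₁ hE₂` (`∀ l`, ONE `(CE₁, CE₂, δE)`); THE TWO LEG ROWS `hL₁ hL₂` on `y_l` (`∀ l`, ONE constant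
  each) = (Q-L) in letter currency; `hC` ((C) at the relative source).
WHAT IS LEFT DISPLAYED on the W-slot's even side after this file and p2's `BlockCommutatorStepLetter` (`hE₁ hE₂` at `ε = 1`, `d = 3`, unconditional modulo the lock
constants' `l`-freeness): D1's raw table laws with parities (the D1 END's own Ward data), the S-slot rows, THE LEG ROWS = (Q-L) (row L11 — (H1)^{⊥} display, OPEN, the located
analytic content), and `hC` ⟸ (C) of record (an2, OPEN).  Asserts NO shape of Bałaban's tables beyond these rows and NO value of any charge; discharges NOTHING of (Q-L) ∕ (C) ∕
«T2Drift» ∕ (hW, hWall); (β) of record untouched; NOT «W-slot closed»; NEVER «G-an2-4 closed» as (CONV-C); NOT D1, NOT `BetaPertH`, NOT continuum, NOT Clay; not in print.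
Unit `b2b-balaban-gan24-formalise-leaf-03` (gen 66), 2026-08-23.
-/

noncomputable section

open Finset
open scoped BigOperators
open Literature.MathematicalPhysics.QuantumFieldTheory
open Literature.MathematicalPhysics.QuantumFieldTheory.Balaban1983to89
open Literature.MathematicalPhysics.QuantumFieldTheory.Balaban1983to89.Beta
open ExpKernelCalculus (MKer shiftK BiLoc Decays comp)
open OneStepResolventKernel (Fib LocStencil)
open OneStepKernelFamily (KInvStep)
open AffineAveraging (box toSite unitVec)
open AveragingMixedJetTables (mixFFAt)
open SecondOrderResponse (W2SymOfK)
open KernelWard (divV)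
open BalabanCompositeJets (LocStencil₂)
open BalabanStepJetsSucc (mmRead)
open BalabanStepW2 (K3OfK M2Of)
open Summit.QuantumFields.BalabanUV.Beta.TameKernelCalculus (trK)
open Summit.QuantumFields.BalabanUV.Beta.BorderedHessian (sgnK)
open Summit.QuantumFields.BalabanUV.Beta.HessKerDressedUnits (unitK unitS)
open Summit.QuantumFields.BalabanUV.Beta.SecondOrderUnits (unitM unitS₂ unitM₂)
open Summit.QuantumFields.BalabanUV.Beta.AxialDressingRooted (coDressKBmAt)
open Summit.QuantumFields.BalabanUV.Beta.SpineRooted (T2RecAt SpureRecAt M1At e3OfK)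
open Summit.QuantumFields.BalabanUV.Beta.WardLocusRecursive (SrecAt)
open Summit.QuantumFields.BalabanUV.Beta.GAN24.CombesThomas (sfStep smStep)
open Summit.QuantumFields.BalabanUV.Beta.GAN24.T2RecursionAffine (lin4)
open Summit.QuantumFields.BalabanUV.Beta.GAN24.BiStencilZeroMode (Tab zmode)
open Summit.QuantumFields.BalabanUV.Beta.GAN24.WSlotCauchyOfShapes (locStencil₂_le_mono)
open Summit.QuantumFields.BalabanUV.Beta.GAN24.T2HybridShapeEnd (locStencil₂_unitS₂_T2RecAt_zero)
open Summit.QuantumFields.BalabanUV.Beta.GAN24.T2ShapeEvenEnd (locStencil₂_halfTable)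
open Summit.QuantumFields.BalabanUV.Beta.GAN24.T2RecSourceRows (source_rows_three_of_srecAt_rows)
open Summit.QuantumFields.BalabanUV.Beta.GAN24.HalfMemberCellOfDivergences (letterRow_fst_of_locStencil₂ letterRow_snd_of_locStencil₂)
open Summit.QuantumFields.BalabanUV.Beta.GAN24.HalfMemberSlavedDivergenceLetters (slotLetters_halfMember_succ_of_rows)
open Summit.QuantumFields.BalabanUV.Beta.GAN24.T2ShapeHalfMemberOfDivergences (locStencil₂_halfMember_three_of_divergence_rows)

namespace Summit.QuantumFields.BalabanUV.Beta.GAN24.T2ShapeHalfMemberOfLetterRows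

/-! ## §0 Merging a member-`0` row with a uniform successor row -/

/-- [folklore] A row for member `0` and ONE row for all successors merge into one row for all members (`max` of the constants, any common smaller rate). -/
theorem rows_of_zero_succ {d : ℕ} {T : ℕ → Tab d} {A B δA δB δ₀ : ℝ} (h0 : LocStencil₂ (T 0) A δA) (hs : ∀ l, LocStencil₂ (T (l + 1)) B δB)
    (hA : δ₀ ≤ δA) (hB : δ₀ ≤ δB) : ∀ l, LocStencil₂ (T l) (max A B) δ₀ := by
  intro l
  cases l with
  | zero => exact locStencil₂_le_mono h0 (le_max_left _ _) hA
  | succ l => exact locStencil₂_le_mono (hs l) (le_max_right _ _) hB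

/-! ## §1 `d = 3`: the shape END with the slot rows supplied level by level -/

section Three

variable {Lc : ℕ} [NeZero Lc] {r : Fin (3 + 1) → ℕ}

/-- NOT IN PRINT; OUR BOOKKEEPING.  **«T2Shape^{ε}» FROM THE RAW TABLE LAWS WITH PARITIES, THE S-SLOT ROWS OF THE SLAVED SUMMAND, THE LEG ROWS AND `hC`** (`d = 3`,
`2 ≤ Lc`, in-block root, `|cE₂| ≤ Lc^8`, `|ε| ≤ 1`): FILE 3a's END with its slot rows `h₂ h₁` supplied — member `0` by FILE 2 §0 (`letterRow_fst ∕ snd_of_locStencil₂` on p2's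
`locStencil₂_unitS₂_T2RecAt_zero` ⨾ the OWNER's `locStencil₂_halfTable`), members `l+1` by leaf-01 g72's PART 4 `slotLetters_halfMember_succ_of_rows` at level `l` with p2's F4
(`source_rows_three_of_srecAt_rows`.1 from `(hS, hSall)`), all at the common rate `min (min δb δE) (min δB δ)`; §0 merges.  DISPLAYED: the raw table laws `hTL hTL″` + parities
`hCm hR hR″` per level (letters `S X R R″ cH`), the S-slot rows `hE₁ hE₂` (`∀ l`, one constant), the LEG rows `hL₁ hL₂` = (Q-L), `hC` = (C).  Nothing of (Q-L) ∕ (C) is discharged. -/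
theorem locStencil₂_halfMember_three_of_letterRows (hLc : 2 ≤ Lc) (hr : r ∈ box (3 + 1) Lc) (cE cVH cΛ cE₂ cB : ℝ)
    (hpin : |cE₂| ≤ (Lc : ℝ) ^ (2 * (3 + 1))) (Tc : Fin 4 → Fin 4 → Fin 4 → Fin 4 → ℝ)
    {vh₂S : Fin (3 + 1) → (Fin (3 + 1) → ℤ) → Fin (3 + 1) → (Fin (3 + 1) → ℤ) → MKer (3 + 1) (Fib 3)}
    (hBff : ∀ κ u κ' u' x z (α β : Fin (3 + 1)), vh₂S κ u κ' u' x z (Sum.inl α) (Sum.inl β) = 0)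
    (hBmm : ∀ κ u κ' u' x z (μ ν : Fin (3 + 1)), vh₂S κ u κ' u' x z (Sum.inr μ) (Sum.inr ν) = 0)
    {CB δB : ℝ} (hB : LocStencil₂ vh₂S CB δB) (hδB : 0 < δB)
    (hBt : ∀ (κ : Fin (3 + 1)) (u : Fin (3 + 1) → ℤ) (κ' : Fin (3 + 1)) (u' t : Fin (3 + 1) → ℤ),
        vh₂S κ (u + (Lc : ℤ) • t) κ' (u' + (Lc : ℤ) • t) = shiftK (-((Lc : ℤ) • t)) (vh₂S κ u κ' u'))
    {Cs cS θS δS : ℝ} (hS : ∀ j, LocStencil (unitS (sfStep Lc j) (smStep 3 Lc j) (SrecAt 3 Lc (toSite r) cE cVH cΛ j)) Cs δS)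
    (hSall : ∀ k j, LocStencil (unitS (sfStep Lc (k + j)) (smStep 3 Lc (k + j)) (SrecAt 3 Lc (toSite r) cE cVH cΛ (k + j)) -
      unitS (sfStep Lc k) (smStep 3 Lc k) (SrecAt 3 Lc (toSite r) cE cVH cΛ k)) (cS * θS ^ k) δS)
    (hδS : 0 < δS) (hθS0 : 0 ≤ θS) (hθS1 : θS < 1)
    (ε : ℝ) (hε : |ε| ≤ 1) {S : ℕ → Fin (3 + 1) → (Fin (3 + 1) → ℤ) → MKer (3 + 1) (Fib 3)} {X : (Fin (3 + 1) → ℤ) → MKer (3 + 1) (Fib 3)}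
    {R R'' : ℕ → (Fin (3 + 1) → ℤ) → Fin (3 + 1) → (Fin (3 + 1) → ℤ) → MKer (3 + 1) (Fib 3)} {cH : ℕ → ℝ} (hcH : ∀ l, cH l ≠ 0)
    (hTL : ∀ (l : ℕ) (Y : Fin (3 + 1) → ℤ) (κ' : Fin (3 + 1)) (u' : Fin (3 + 1) → ℤ),
      cH l • ∑ v ∈ box (3 + 1) Lc, divV (fun κ u => T2RecAt 3 Lc (toSite r) cE cVH cΛ cE₂ cB Tc vh₂S (mixFFAt (toSite r) Lc) l κ u κ' u') ((Lc : ℤ) • Y + toSite v)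
        = comp (S l κ' u') (X Y) - comp (X Y) (S l κ' u') + R l Y κ' u')
    (hTL'' : ∀ (l : ℕ) (Y : Fin (3 + 1) → ℤ) (κ : Fin (3 + 1)) (u : Fin (3 + 1) → ℤ),
      cH l • ∑ v ∈ box (3 + 1) Lc, divV (T2RecAt 3 Lc (toSite r) cE cVH cΛ cE₂ cB Tc vh₂S (mixFFAt (toSite r) Lc) l κ u) ((Lc : ℤ) • Y + toSite v)
        = comp (S l κ u) (X Y) - comp (X Y) (S l κ u) + R'' l Y κ u)
    (hCm : ∀ (l : ℕ) (Y : Fin (3 + 1) → ℤ) (κ : Fin (3 + 1)) (u : Fin (3 + 1) → ℤ),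
      trK (comp (S l κ u) (X Y) - comp (X Y) (S l κ u)) = sgnK (comp (S l κ u) (X Y) - comp (X Y) (S l κ u)))
    (hR : ∀ (l : ℕ) (Y : Fin (3 + 1) → ℤ) (κ : Fin (3 + 1)) (u : Fin (3 + 1) → ℤ), trK (R l Y κ u) = -sgnK (R l Y κ u))
    (hR'' : ∀ (l : ℕ) (Y : Fin (3 + 1) → ℤ) (κ : Fin (3 + 1)) (u : Fin (3 + 1) → ℤ), trK (R'' l Y κ u) = -sgnK (R'' l Y κ u))
    {CE₁ CE₂ δE : ℝ} (hδE : 0 < δE)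
    (hE₁ : ∀ l, LocStencil₂ (fun (_ : Fin (3 + 1)) (p : Fin (3 + 1) → ℤ) (κ' : Fin (3 + 1)) (u' : Fin (3 + 1) → ℤ) =>
          (cE₂ * (Lc : ℝ) ^ (2 * (3 + 1)) * ((Lc : ℝ) ^ (3 + 1))⁻¹ / 2) •
            (e3OfK Lc (unitK (sfStep Lc l) (smStep 3 Lc l) (coDressKBmAt (toSite r) Lc (KInvStep (d := 3) Lc l)))
              (fun κ' u' => (sfStep Lc l * smStep 3 Lc l)⁻¹ • unitS (sfStep Lc l) (smStep 3 Lc l)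
                (fun κ' u' => (cH l)⁻¹ • ((((1 : ℝ) + ε) / 2) • (comp (S l κ' u') (X p) - comp (X p) (S l κ' u')) + (((1 : ℝ) - ε) / 2) • R l p κ' u')) κ' u') κ' u'
            + e3OfK Lc (unitK (sfStep Lc l) (smStep 3 Lc l) (coDressKBmAt (toSite r) Lc (KInvStep (d := 3) Lc l)))
              (fun κ u => (sfStep Lc l * smStep 3 Lc l)⁻¹ • unitS (sfStep Lc l) (smStep 3 Lc l)
                (fun κ u => (cH l)⁻¹ • ((((1 : ℝ) + ε) / 2) • (comp (S l κ u) (X p) - comp (X p) (S l κ u)) + (((1 : ℝ) - ε) / 2) • R'' l p κ u)) κ u) κ' u')) CE₁ δE)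
    (hE₂ : ∀ l, LocStencil₂ (fun (κ : Fin (3 + 1)) (u : Fin (3 + 1) → ℤ) (_ : Fin (3 + 1)) (p : Fin (3 + 1) → ℤ) =>
          (cE₂ * (Lc : ℝ) ^ (2 * (3 + 1)) * ((Lc : ℝ) ^ (3 + 1))⁻¹ / 2) •
            (e3OfK Lc (unitK (sfStep Lc l) (smStep 3 Lc l) (coDressKBmAt (toSite r) Lc (KInvStep (d := 3) Lc l)))
              (fun κ' u' => (sfStep Lc l * smStep 3 Lc l)⁻¹ • unitS (sfStep Lc l) (smStep 3 Lc l)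
                (fun κ' u' => (cH l)⁻¹ • ((((1 : ℝ) + ε) / 2) • (comp (S l κ' u') (X p) - comp (X p) (S l κ' u')) + (((1 : ℝ) - ε) / 2) • R l p κ' u')) κ' u') κ u
            + e3OfK Lc (unitK (sfStep Lc l) (smStep 3 Lc l) (coDressKBmAt (toSite r) Lc (KInvStep (d := 3) Lc l)))
              (fun κ u => (sfStep Lc l * smStep 3 Lc l)⁻¹ • unitS (sfStep Lc l) (smStep 3 Lc l)
                (fun κ u => (cH l)⁻¹ • ((((1 : ℝ) + ε) / 2) • (comp (S l κ u) (X p) - comp (X p) (S l κ u)) + (((1 : ℝ) - ε) / 2) • R'' l p κ u)) κ u) κ u)) CE₂ δE)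
    {CL₁ CL₂ δ : ℝ} (hδ : 0 < δ)
    (hL₁ : ∀ l, LocStencil₂ (fun κ u κ' u' => fun (p z : Fin (3 + 1) → ℤ) (_ : Fib 3) (b : Fib 3) =>
      ∑ β : Fin (3 + 1), ((((1 : ℝ) / 2) • (unitS₂ (sfStep Lc l) (smStep 3 Lc l) (T2RecAt 3 Lc (toSite r) cE cVH cΛ cE₂ cB Tc vh₂S (mixFFAt (toSite r) Lc) l)
        + ε • fun κ u κ' u' => sgnK (trK ((unitS₂ (sfStep Lc l) (smStep 3 Lc l) (T2RecAt 3 Lc (toSite r) cE cVH cΛ cE₂ cB Tc vh₂S (mixFFAt (toSite r) Lc) l))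
          κ u κ' u')))) κ u κ' u' p z (Sum.inl β) b
        - (((1 : ℝ) / 2) • (unitS₂ (sfStep Lc l) (smStep 3 Lc l) (T2RecAt 3 Lc (toSite r) cE cVH cΛ cE₂ cB Tc vh₂S (mixFFAt (toSite r) Lc) l)
        + ε • fun κ u κ' u' => sgnK (trK ((unitS₂ (sfStep Lc l) (smStep 3 Lc l) (T2RecAt 3 Lc (toSite r) cE cVH cΛ cE₂ cB Tc vh₂S (mixFFAt (toSite r) Lc) l))
          κ u κ' u')))) κ u κ' u' (p - unitVec β) z (Sum.inl β) b)) CL₁ δ)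
    (hL₂ : ∀ l, LocStencil₂ (fun κ u κ' u' => fun (x p : Fin (3 + 1) → ℤ) (a : Fib 3) (_ : Fib 3) =>
      ∑ β : Fin (3 + 1), ((((1 : ℝ) / 2) • (unitS₂ (sfStep Lc l) (smStep 3 Lc l) (T2RecAt 3 Lc (toSite r) cE cVH cΛ cE₂ cB Tc vh₂S (mixFFAt (toSite r) Lc) l)
        + ε • fun κ u κ' u' => sgnK (trK ((unitS₂ (sfStep Lc l) (smStep 3 Lc l) (T2RecAt 3 Lc (toSite r) cE cVH cΛ cE₂ cB Tc vh₂S (mixFFAt (toSite r) Lc) l))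
          κ u κ' u')))) κ u κ' u' x p a (Sum.inl β)
        - (((1 : ℝ) / 2) • (unitS₂ (sfStep Lc l) (smStep 3 Lc l) (T2RecAt 3 Lc (toSite r) cE cVH cΛ cE₂ cB Tc vh₂S (mixFFAt (toSite r) Lc) l)
        + ε • fun κ u κ' u' => sgnK (trK ((unitS₂ (sfStep Lc l) (smStep 3 Lc l) (T2RecAt 3 Lc (toSite r) cE cVH cΛ cE₂ cB Tc vh₂S (mixFFAt (toSite r) Lc) l))
          κ u κ' u')))) κ u κ' u' x (p - unitVec β) a (Sum.inl β))) CL₂ δ)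
    (hC : ∀ l, ∀ κ κ' κ₁ κ₂, zmode Lc (((1 : ℝ) / 2) • ((fun κ u κ' u' => (cE₂ * (Lc : ℝ) ^ (2 * (3 + 1))) • mmRead Lc (K3OfK (unitK (sfStep Lc l) (smStep 3 Lc
          l) (coDressKBmAt (toSite r) Lc (KInvStep (d := 3) Lc l))) Lc (unitS (sfStep Lc l) (smStep 3 Lc l) (SpureRecAt 3 Lc (toSite r) cE cVH cΛ l)) (unitM
          (sfStep Lc l) (smStep 3 Lc l) (M1At 3 Lc (toSite r) cΛ l)) (W2SymOfK (unitK (sfStep Lc l) (smStep 3 Lc l) (coDressKBmAt (toSite r) Lc (KInvStep (d :=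
          3) Lc l))) Lc (unitS (sfStep Lc l) (smStep 3 Lc l) (SpureRecAt 3 Lc (toSite r) cE cVH cΛ l)) (unitM (sfStep Lc l) (smStep 3 Lc l) (M1At 3 Lc (toSite
          r) cΛ l)) 0 (unitM₂ (sfStep Lc l) (smStep 3 Lc l) (M2Of 3 Lc (mixFFAt (toSite r) Lc) l))) κ u κ' u') + cB • vh₂S κ u κ' u') + ε • fun κ u κ' u' =>
          sgnK (trK ((cE₂ * (Lc : ℝ) ^ (2 * (3 + 1))) • mmRead Lc (K3OfK (unitK (sfStep Lc l) (smStep 3 Lc l) (coDressKBmAt (toSite r) Lc (KInvStep (d := 3) Lc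
          l))) Lc (unitS (sfStep Lc l) (smStep 3 Lc l) (SpureRecAt 3 Lc (toSite r) cE cVH cΛ l)) (unitM (sfStep Lc l) (smStep 3 Lc l) (M1At 3 Lc (toSite r) cΛ
          l)) (W2SymOfK (unitK (sfStep Lc l) (smStep 3 Lc l) (coDressKBmAt (toSite r) Lc (KInvStep (d := 3) Lc l))) Lc (unitS (sfStep Lc l) (smStep 3 Lc l)
          (SpureRecAt 3 Lc (toSite r) cE cVH cΛ l)) (unitM (sfStep Lc l) (smStep 3 Lc l) (M1At 3 Lc (toSite r) cΛ l)) 0 (unitM₂ (sfStep Lc l) (smStep 3 Lc l)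
          (M2Of 3 Lc (mixFFAt (toSite r) Lc) l))) κ u κ' u') + cB • vh₂S κ u κ' u'))) +
          (lin4 (cE₂ * (Lc : ℝ) ^ (2 * (3 + 1))) (unitK (sfStep Lc l) (smStep 3 Lc l) (coDressKBmAt (toSite r) Lc (KInvStep (d := 3) Lc l))) Lc (((1 : ℝ) / 2)
                • (unitS₂ (sfStep Lc l) (smStep 3 Lc l) (T2RecAt 3 Lc (toSite r) cE cVH cΛ cE₂ cB Tc vh₂S (mixFFAt (toSite r) Lc) l) + ε • fun κ u κ' u' =>
                sgnK (trK ((unitS₂ (sfStep Lc l) (smStep 3 Lc l) (T2RecAt 3 Lc (toSite r) cE cVH cΛ cE₂ cB Tc vh₂S (mixFFAt (toSite r) Lc) l)) κ u κ' u')))) -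
            lin4 (cE₂ * (Lc : ℝ) ^ (2 * (3 + 1))) (unitK (sfStep Lc l) (smStep 3 Lc l) (KInvStep (d := 3) Lc l)) Lc (((1 : ℝ) / 2) • (unitS₂ (sfStep Lc l)
                  (smStep 3 Lc l) (T2RecAt 3 Lc (toSite r) cE cVH cΛ cE₂ cB Tc vh₂S (mixFFAt (toSite r) Lc) l) + ε • fun κ u κ' u' => sgnK (trK ((unitS₂
                  (sfStep Lc l) (smStep 3 Lc l) (T2RecAt 3 Lc (toSite r) cE cVH cΛ cE₂ cB Tc vh₂S (mixFFAt (toSite r) Lc) l)) κ u κ' u')))))) κ κ' (Sum.inl κ₁)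
                  (Sum.inl κ₂) + zmode Lc (((1 : ℝ) / 2) • ((fun κ u κ' u' => (cE₂ * (Lc : ℝ) ^ (2 * (3 + 1))) • mmRead Lc (K3OfK (unitK (sfStep Lc l) (smStep
                  3 Lc l) (coDressKBmAt (toSite r) Lc (KInvStep (d := 3) Lc l))) Lc (unitS (sfStep Lc l) (smStep 3 Lc l) (SpureRecAt 3 Lc (toSite r) cE cVH cΛ
                  l)) (unitM (sfStep Lc l) (smStep 3 Lc l) (M1At 3 Lc (toSite r) cΛ l)) (W2SymOfK (unitK (sfStep Lc l) (smStep 3 Lc l) (coDressKBmAt (toSite r)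
                  Lc (KInvStep (d := 3) Lc l))) Lc (unitS (sfStep Lc l) (smStep 3 Lc l) (SpureRecAt 3 Lc (toSite r) cE cVH cΛ l)) (unitM (sfStep Lc l) (smStep
                  3 Lc l) (M1At 3 Lc (toSite r) cΛ l)) 0 (unitM₂ (sfStep Lc l) (smStep 3 Lc l) (M2Of 3 Lc (mixFFAt (toSite r) Lc) l))) κ u κ' u') + cB • vh₂S κ
                  u κ' u') + ε • fun κ u κ' u' => sgnK (trK ((cE₂ * (Lc : ℝ) ^ (2 * (3 + 1))) • mmRead Lc (K3OfK (unitK (sfStep Lc l) (smStep 3 Lc l)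
                  (coDressKBmAt (toSite r) Lc (KInvStep (d := 3) Lc l))) Lc (unitS (sfStep Lc l) (smStep 3 Lc l) (SpureRecAt 3 Lc (toSite r) cE cVH cΛ l))
                  (unitM (sfStep Lc l) (smStep 3 Lc l) (M1At 3 Lc (toSite r) cΛ l)) (W2SymOfK (unitK (sfStep Lc l) (smStep 3 Lc l) (coDressKBmAt (toSite r) Lc
                  (KInvStep (d := 3) Lc l))) Lc (unitS (sfStep Lc l) (smStep 3 Lc l) (SpureRecAt 3 Lc (toSite r) cE cVH cΛ l)) (unitM (sfStep Lc l) (smStep 3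
                  Lc l) (M1At 3 Lc (toSite r) cΛ l)) 0 (unitM₂ (sfStep Lc l) (smStep 3 Lc l) (M2Of 3 Lc (mixFFAt (toSite r) Lc) l))) κ u κ' u') + cB • vh₂S κ u κ' u'))) +
          (lin4 (cE₂ * (Lc : ℝ) ^ (2 * (3 + 1))) (unitK (sfStep Lc l) (smStep 3 Lc l) (coDressKBmAt (toSite r) Lc (KInvStep (d := 3) Lc l))) Lc (((1 : ℝ) / 2)
                • (unitS₂ (sfStep Lc l) (smStep 3 Lc l) (T2RecAt 3 Lc (toSite r) cE cVH cΛ cE₂ cB Tc vh₂S (mixFFAt (toSite r) Lc) l) + ε • fun κ u κ' u' =>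
                sgnK (trK ((unitS₂ (sfStep Lc l) (smStep 3 Lc l) (T2RecAt 3 Lc (toSite r) cE cVH cΛ cE₂ cB Tc vh₂S (mixFFAt (toSite r) Lc) l)) κ u κ' u')))) -
            lin4 (cE₂ * (Lc : ℝ) ^ (2 * (3 + 1))) (unitK (sfStep Lc l) (smStep 3 Lc l) (KInvStep (d := 3) Lc l)) Lc (((1 : ℝ) / 2) • (unitS₂ (sfStep Lc l)
                  (smStep 3 Lc l) (T2RecAt 3 Lc (toSite r) cE cVH cΛ cE₂ cB Tc vh₂S (mixFFAt (toSite r) Lc) l) + ε • fun κ u κ' u' => sgnK (trK ((unitS₂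
                  (sfStep Lc l) (smStep 3 Lc l) (T2RecAt 3 Lc (toSite r) cE cVH cΛ cE₂ cB Tc vh₂S (mixFFAt (toSite r) Lc) l)) κ u κ' u')))))) κ' κ (Sum.inl κ₁)
                  (Sum.inl κ₂) = 0) :
    ∃ C₂ δ₂ : ℝ, 0 < δ₂ ∧ ∀ n, LocStencil₂ (((1 : ℝ) / 2) • (unitS₂ (sfStep Lc n) (smStep 3 Lc n) (T2RecAt 3 Lc (toSite r) cE cVH cΛ cE₂ cB Tc vh₂S (mixFFAt
          (toSite r) Lc) n) + ε • fun κ u κ' u' => sgnK (trK ((unitS₂ (sfStep Lc n) (smStep 3 Lc n) (T2RecAt 3 Lc (toSite r) cE cVH cΛ cE₂ cB Tc vh₂S (mixFFAt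
          (toSite r) Lc) n)) κ u κ' u')))) C₂ δ₂ := by
  have hLc1 : 1 ≤ Lc := le_trans (by norm_num) hLc
  -- p2's F4: the dressed comb sources are uniformly `LocStencil₂` (from the S-slot rows)
  obtain ⟨⟨Cb, δb, hδb, hbF4⟩, -⟩ := source_rows_three_of_srecAt_rows hLc hr cE cVH cΛ cE₂ cB (vh₂S := vh₂S) hB hδB hS hSall hδS hθS0 hθS1
  -- the common rate
  have hδ₀ : 0 < min (min δb δE) (min δB δ) := lt_min (lt_min hδb hδE) (lt_min hδB hδ)
  have hδ₀b : min (min δb δE) (min δB δ) ≤ δb := (min_le_left _ _).trans (min_le_left _ _)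
  have hδ₀E : min (min δb δE) (min δB δ) ≤ δE := (min_le_left _ _).trans (min_le_right _ _)
  have hδ₀B : min (min δb δE) (min δB δ) ≤ δB := (min_le_right _ _).trans (min_le_left _ _)
  have hδ₀L : min (min δb δE) (min δB δ) ≤ δ := (min_le_right _ _).trans (min_le_right _ _)
  -- member 0: its own shape (p2 ⨾ the OWNER), then FILE 2 §0
  have h0 := locStencil₂_halfTable (locStencil₂_unitS₂_T2RecAt_zero (d := 3) (Lc := Lc) (toSite r) cE cVH cΛ cE₂ cB Tc (mixFFAt (toSite r) Lc) hB hδB.le le_rfl) hε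
  have h0₁ := letterRow_fst_of_locStencil₂ h0 hδB.le
  have h0₂ := letterRow_snd_of_locStencil₂ h0 hδB.le
  -- members l+1: (b1) PART 4 at level l, at the common rate
  have hsucc := fun l => slotLetters_halfMember_succ_of_rows (d := 3) hLc1 hr cE cVH cΛ cE₂ cB Tc hBff hBmm ⟨CB, δB, hδB, hB⟩ l (hcH l) (hTL l) (hTL'' l)
    (hCm l) (hR l) (hR'' l) ε hε hδ₀.le ((hbF4 l).mono hδ₀b) ((hE₁ l).mono hδ₀E) ((hE₂ l).mono hδ₀E)
  have h₁ := rows_of_zero_succ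
    (T := fun l => fun (_ : Fin (3 + 1)) (p : Fin (3 + 1) → ℤ) (κ' : Fin (3 + 1)) (u' : Fin (3 + 1) → ℤ) =>
      divV (fun κ₁ u₁ => (((1 : ℝ) / 2) • (unitS₂ (sfStep Lc l) (smStep 3 Lc l) (T2RecAt 3 Lc (toSite r) cE cVH cΛ cE₂ cB Tc vh₂S (mixFFAt (toSite r) Lc) l)
        + ε • fun κ u κ' u' => sgnK (trK ((unitS₂ (sfStep Lc l) (smStep 3 Lc l) (T2RecAt 3 Lc (toSite r) cE cVH cΛ cE₂ cB Tc vh₂S (mixFFAt (toSite r) Lc) l))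
          κ u κ' u')))) κ₁ u₁ κ' u') p)
    h0₁ (fun l => (hsucc l).1) hδ₀B le_rfl
  have h₂ := rows_of_zero_succ
    (T := fun l => fun (κ : Fin (3 + 1)) (u : Fin (3 + 1) → ℤ) (_ : Fin (3 + 1)) (p : Fin (3 + 1) → ℤ) =>
      divV (fun κ₁ u₁ => (((1 : ℝ) / 2) • (unitS₂ (sfStep Lc l) (smStep 3 Lc l) (T2RecAt 3 Lc (toSite r) cE cVH cΛ cE₂ cB Tc vh₂S (mixFFAt (toSite r) Lc) l)
        + ε • fun κ u κ' u' => sgnK (trK ((unitS₂ (sfStep Lc l) (smStep 3 Lc l) (T2RecAt 3 Lc (toSite r) cE cVH cΛ cE₂ cB Tc vh₂S (mixFFAt (toSite r) Lc) l))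
          κ u κ' u')))) κ u κ₁ u₁) p)
    h0₂ (fun l => (hsucc l).2) hδ₀B le_rfl
  exact locStencil₂_halfMember_three_of_divergence_rows hLc hr cE cVH cΛ cE₂ cB hpin Tc hBff hBmm hB hδB hBt hS hSall hδS hθS0 hθS1 ε hε hδ₀ h₂ h₁
    (fun l => (hL₁ l).mono hδ₀L) (fun l => (hL₂ l).mono hδ₀L) hC

end Three

end Summit.QuantumFields.BalabanUV.Beta.GAN24.T2ShapeHalfMemberOfLetterRows

end
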